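import Literature.Topology.FourManifolds.ChartCircleTrace
import Literature.Topology.FourManifolds.HCobordantOfDiffeomorph
import Literature.Barriers.SmoothPoincare4.ExoticContractibleKangStabilisationProofs
import HarnessLib

/-!
# The elementary cobordism from `X` to a GIVEN stabilisation `X # S² × S²`, with its homology

Topic `Literature/Topology/FourManifolds` (fact seat of
`Literature.Topology.FourManifolds.isHCobordant_of_equivalent_intersectionForm`, Wall 1964 Thm. 2, along
R. Kirby's proof, *The topology of 4-manifolds*, LNM 1374 (1989), Ch. X, proof of Thm. 1,
pp. 55–56).  Sequel of `ChartCircleTrace.lean`: there the trace `ω` of the surgery along the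
standard framed circle of a chart `C` of the closed simply connected smooth 4-manifold `X` was
shown to be an elementary cobordism of index `2` from `X` to its top end `C.Top`, itself a connected
sum `X # S² × S²` (`StdChart.topNeck`), with the cylinder law and the vanishing of the belt sphere.
Here the top end is replaced by ANY given connected sum `P'` of `X` with `S² × S²`
(`IsConnectedSum (𝓡 4) (𝓡 4) ((𝓡 2).prod (𝓡 2)) X (S² × S²) P'`, e.g. a step of a stabilisation
chain `IsStabilization`): by the uniqueness of the connected sum with the amphichiral `S² × S²`
(`nonempty_diffeomorph_of_isConnectedSum_of_discs_equivalent` with `sphereTwoProd_discs_equivalent`;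
Kervaire–Milnor 1963, Lemma 2.1; Wall 1964, §1) there is a diffeomorphism `Ψ : C.Top ≅ P'`, along
which the cobordism is re-ended (`Cobordism.compDiffeomorphRight`) and the connected-sum structure
of the top end is transported.

* `exists_stabilisationStep` — **for every connected sum `P'` of a closed simply connected smooth
  4-manifold `X` with `S² × S²` there are a cobordism `E` from `X` to `P'` and a presentation
  `d : ConnectedSumNeck 4 X (S² × S²) P'` of `P'` as `X # S² × S²` such that: `E` is simply
  connected; `H₂(P') → H₂(E)` is onto; the CYLINDER LAW `(inr ∘ d.jA)_* = (inl ∘ incl)_*` on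
  `H⁎(X ∖ {pt})`; the BELT LAW — the fibre `{n} × S²` of the new summand, pushed into `P'` by
  `d.jB` and into `E`, is null-homologous; and `P'` is simply connected** (Kirby 1989, p. 56).

Everything is proved; no definitions beyond the transported neck; no named facts (D-0026).

## References

* R. C. Kirby, *The topology of 4-manifolds*, LNM 1374 (1989), Ch. X, proof of Thm. 1, pp. 55–56.
  [Kirby1989]
* M. Kervaire, J. Milnor, *Groups of homotopy spheres I*, Ann. of Math. 77 (1963), §2, Lemma 2.1.
  [KervaireMilnorAnnals1963]
* C. T. C. Wall, *On simply-connected 4-manifolds*, J. London Math. Soc. 39 (1964), §1. [WallJLMS1964]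
-/

noncomputable section

open scoped Manifold ContDiff Topology
open Set Function CategoryTheory
open Literature.AlgebraicTopology.SingularHomology

namespace Literature.Topology.FourManifolds

/-- Local notation: `𝔼 n` is the model Euclidean space `EuclideanSpace ℝ (Fin n)`. -/
local notation "𝔼 " n:arg => EuclideanSpace ℝ (Fin n)
/-- Local notation: `𝕊 n` is the unit sphere in `EuclideanSpace ℝ (Fin (n + 1))`. -/
local notation "𝕊 " n:arg => (Metric.sphere (0 : EuclideanSpace ℝ (Fin (n + 1))) 1)

namespace ConnectedSumNeck

variable {n : ℕ} {M N P P' : Type*} [TopologicalSpace M] [T1Space M] [TopologicalSpace N]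
  [T1Space N] [TopologicalSpace P] [TopologicalSpace P']

/-- **Transport of connected-sum gluing data along a homeomorphism of the glued space.** [cite: KervaireMilnorAnnals1963, §2] -/
def mapHomeomorph (d : ConnectedSumNeck n M N P) (e : P ≃ₜ P') : ConnectedSumNeck n M N P' where
  i₁ := d.i₁
  i₂ := d.i₂
  jA := e ∘ d.jA
  jB := e ∘ d.jB
  continuous_i₁ := d.continuous_i₁
  injective_i₁ := d.injective_i₁
  continuous_i₂ := d.continuous_i₂
  injective_i₂ := d.injective_i₂
  isEmbedding_jA := e.isEmbedding.comp d.isEmbedding_jA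
  isEmbedding_jB := e.isEmbedding.comp d.isEmbedding_jB
  isOpen_range_jA := by rw [range_comp]; exact e.isOpenMap _ d.isOpen_range_jA
  isOpen_range_jB := by rw [range_comp]; exact e.isOpenMap _ d.isOpen_range_jB
  union_range := by
    rw [range_comp, range_comp, ← image_union, d.union_range, image_univ, e.range_coe]
  rel a b := by
    rw [comp_apply, comp_apply, e.injective.eq_iff, d.rel]

/-- The pieces of the transported data. [folklore] -/
@[simp] theorem mapHomeomorph_jA (d : ConnectedSumNeck n M N P) (e : P ≃ₜ P') :
    (d.mapHomeomorph e).jA = e ∘ d.jA := rfl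

/-- The pieces of the transported data. [folklore] -/
@[simp] theorem mapHomeomorph_jB (d : ConnectedSumNeck n M N P) (e : P ≃ₜ P') :
    (d.mapHomeomorph e).jB = e ∘ d.jB := rfl

/-- The discs of the transported data. [folklore] -/
@[simp] theorem mapHomeomorph_i₁ (d : ConnectedSumNeck n M N P) (e : P ≃ₜ P') :
    (d.mapHomeomorph e).i₁ = d.i₁ := rfl

/-- The discs of the transported data. [folklore] -/
@[simp] theorem mapHomeomorph_i₂ (d : ConnectedSumNeck n M N P) (e : P ≃ₜ P') :
    (d.mapHomeomorph e).i₂ = d.i₂ := rfl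

end ConnectedSumNeck

section Step

open StdCircleSurgery StdChart

variable (X : Type) [TopologicalSpace X] [ChartedSpace (𝔼 4) X] [T2Space X] [SecondCountableTopology X]
  [IsManifold (𝓡 4) ∞ X] [CompactSpace X] [SimplyConnectedSpace X]
  (P' : Type) [TopologicalSpace P'] [ChartedSpace (𝔼 4) P'] [IsManifold (𝓡 4) ∞ P']

/-- **The elementary cobordism from `X` to a given `X # S² × S²`, with its homological laws**
(Kirby 1989, Ch. X pp. 55–56: one 2-handle on a trivial framed circle of `M₀ × I` gives a bordism to
`M₀ # S² × S²`; its belt sphere bounds, and classes of `M₀` pass through the cylinder).  For a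
closed simply connected smooth 4-manifold `X` and a connected sum `P'` of `X` with `S² × S²` there
are a cobordism `E : X ~ P'` and a presentation `d` of `P'` as `X # S² × S²` (discs `d.i₁`, `d.i₂`,
pieces `d.jA : X ∖ {pt} → P'`, `d.jB : S² × S² ∖ {pt} → P'`) such that `E` is simply connected,
`H₂(P') → H₂(E)` is onto, `(E.inr ∘ d.jA)_* = (E.inl ∘ incl)_*` on the homology of `X ∖ {pt}`, the
fibre sphere `v ↦ (n, v)` of the new summand pushed by `d.jB` dies in `H₂(E)`, and `P'` is simply
connected (and compact, second countable). [cite: Kirby1989, Ch. X, proof of Thm. 1, pp. 55–56] [cite: MilnorHCobordism1965, Thm. 3.12, Cor. 3.15] [cite: KervaireMilnorAnnals1963, Lemma 2.1] -/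
theorem exists_stabilisationStep
    (h : IsConnectedSum (𝓡 4) (𝓡 4) ((𝓡 2).prod (𝓡 2)) X ((𝕊 2) × (𝕊 2)) P') :
    ∃ (E : Cobordism 4 X P') (_ : SimplyConnectedSpace E.W) (d : ConnectedSumNeck 4 X ((𝕊 2) × (𝕊 2)) P')
      (s : C(𝕊 2, ↥(puncture d.i₂))),
      Epi (singularHomology.map ℤ ℤ (⟨E.inr, E.continuous_inr⟩ : C(P', E.W)) 2) ∧
      (∀ j, singularHomology.map ℤ ℤ ((⟨E.inr, E.continuous_inr⟩ : C(P', E.W)).comp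
          ⟨d.jA, d.isEmbedding_jA.continuous⟩) j =
        singularHomology.map ℤ ℤ ((⟨E.inl, E.continuous_inl⟩ : C(X, E.W)).comp
          ⟨Subtype.val, continuous_subtype_val⟩) j) ∧
      (∀ v, ((s v : ↥(puncture d.i₂)) : (𝕊 2) × (𝕊 2)) =
        (⟨discChart 0, mem_sphere_zero_iff_norm.2 (norm_discChart _)⟩, v)) ∧
      singularHomology.map ℤ ℤ ((⟨E.inr, E.continuous_inr⟩ : C(P', E.W)).comp
          ((⟨d.jB, d.isEmbedding_jB.continuous⟩ : C(↥(puncture d.i₂), P')).comp s)) 2 = 0 ∧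
      SimplyConnectedSpace P' ∧ CompactSpace P' ∧ SecondCountableTopology P' := by
  -- a chart of `X` and its trace
  obtain ⟨x₀⟩ := (inferInstance : Nonempty X)
  obtain ⟨C, -, -⟩ := StdChart.exists_mem_source x₀
  -- the top end of the trace is diffeomorphic to the given `P'`
  obtain ⟨-, r, -, hr, -⟩ := Literature.Barriers.SmoothPoincare4.exists_split_reflection
  have hE : Module.finrank ℝ (𝔼 4) ≠ 0 := by simp
  obtain ⟨Ψ⟩ : Nonempty (C.Top ≃ₘ⟮𝓡 4, 𝓡 4⟯ P') :=
    nonempty_diffeomorph_of_isConnectedSum_of_discs_equivalent hE r hr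
      Literature.Barriers.SmoothPoincare4.sphereTwoProd_discs_equivalent C.isConnectedSum_top h
  -- the re-ended cobordism and the transported neck
  let E : Cobordism 4 X P' := C.trace.compDiffeomorphRight Ψ.symm
  let d : ConnectedSumNeck 4 X ((𝕊 2) × (𝕊 2)) P' := C.topNeck.mapHomeomorph Ψ.toHomeomorph
  haveI hsc : SimplyConnectedSpace E.W := C.simplyConnectedSpace_trace
  have hP'sc : SimplyConnectedSpace P' := by
    haveI := C.simplyConnectedSpace_top
    exact Ψ.symm.toHomeomorph.toHomotopyEquiv.simplyConnectedSpace
  have hP'c : CompactSpace P' := Ψ.toHomeomorph.compactSpace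
  have hP'sc2 : SecondCountableTopology P' := Ψ.symm.toHomeomorph.secondCountableTopology
  refine ⟨E, hsc, d, beltSphere, ?_, fun j => ?_, fun v => rfl, ?_, hP'sc, hP'c, hP'sc2⟩
  · -- `H₂(P') → H₂(E)` onto: `inr_E = inr ∘ Ψ⁻¹`
    haveI : IsIso (singularHomology.map ℤ ℤ (Ψ.symm.toHomeomorph : C(P', C.Top)) 2) := by
      change IsIso (singularHomology.mapIso ℤ ℤ Ψ.symm.toHomeomorph 2).hom
      infer_instance
    haveI := C.epi_map_inr_trace_two
    have key : Epi (singularHomology.map ℤ ℤ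
        ((⟨C.trace.inr, C.trace.continuous_inr⟩ : C(C.Top, C.trace.W)).comp (Ψ.symm.toHomeomorph : C(P', C.Top))) 2) := by
      rw [singularHomology.map_comp]
      apply epi_comp
    exact key
  · -- the cylinder law, transported: `inr_E ∘ d.jA = inr ∘ Ψ⁻¹ ∘ Ψ ∘ jA = inr ∘ jA`
    have hfac : (⟨E.inr, E.continuous_inr⟩ : C(P', E.W)).comp ⟨d.jA, d.isEmbedding_jA.continuous⟩ =
        (⟨C.trace.inr, C.trace.continuous_inr⟩ : C(C.Top, C.trace.W)).comp
          ⟨C.topNeck.jA, C.topNeck.isEmbedding_jA.continuous⟩ := by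
      ext a
      show C.trace.inr (Ψ.symm (Ψ (C.topNeck.jA a))) = C.trace.inr (C.topNeck.jA a)
      rw [Ψ.symm_apply_apply]
    have hfac' : (⟨E.inl, E.continuous_inl⟩ : C(X, E.W)).comp ⟨Subtype.val, continuous_subtype_val⟩ =
        (⟨C.trace.inl, C.trace.continuous_inl⟩ : C(X, C.trace.W)).comp
          (⟨Subtype.val, continuous_subtype_val⟩ : C(↥(puncture C.i), X)) := by
      ext a; rfl
    exact (congrArg (fun f => singularHomology.map ℤ ℤ f j) hfac).trans
      ((C.map_inr_topNeck_jA_eq j).trans (congrArg (fun f => singularHomology.map ℤ ℤ f j) hfac').symm)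
  · -- the belt law, transported
    have hfac : (⟨E.inr, E.continuous_inr⟩ : C(P', E.W)).comp
        ((⟨d.jB, d.isEmbedding_jB.continuous⟩ : C(↥(puncture d.i₂), P')).comp beltSphere) =
        (⟨C.trace.inr, C.trace.continuous_inr⟩ : C(C.Top, C.trace.W)).comp
          ((⟨C.topNeck.jB, C.topNeck.isEmbedding_jB.continuous⟩ : C(↥(puncture modelDisc), C.Top)).comp beltSphere) := by
      ext v
      show C.trace.inr (Ψ.symm (Ψ (C.topNeck.jB (beltSphere v)))) = C.trace.inr (C.topNeck.jB (beltSphere v))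
      rw [Ψ.symm_apply_apply]
    exact (congrArg (fun f => singularHomology.map ℤ ℤ f 2) hfac).trans C.map_inr_jB_beltSphere_eq_zero

end Step

end Literature.Topology.FourManifolds
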